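import Literature.NumberTheory.Transcendental.CurvePeriodsPathHomotopicProofs
import Mathlib.Analysis.Convex.Contractible
import Mathlib.AlgebraicTopology.FundamentalGroupoid.SimplyConnected
import HarnessLib

/-!
# `BetaLinearSector` (stmt-KontsevichZagierPeriods-3897), line `fermat-sector-transport`:
# SECTOR STUB H1 `stub_sectorLoopZ` — a loop on the affine Fermat curve lying on a chart over a
# star-shaped planar set has symbol `∼ 0`

Section `Sector` of the line realises the Fermat reflection coincidence
`B(a,b) = [sin π(a+b)/sin πa]·B(1−a−b,b)` as Cauchy's theorem on the sector `{0 ≤ arg x ≤ π/N}` of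
one sheet of the Fermat curve `F_N : x^N + y^N = 1`, written as an explicit elementary
decomposition (relations (R1)–(R5), `CurvePeriods.IsElementaryRelation`) of a relation among
period symbols `(F_N, ω, path)`.  This file is the PURE TOPOLOGY of the loop in the affine chart:

* `span_single_of_loop_over_starConvex` — for ANY smooth affine curve `Z`, a set `S ⊆ ℂ`
  star-shaped at a point, a map `Φ : ℂ → ℂⁿ` continuous on `S` with `Φ(S) ⊆ Z(ℂ)` and a
  continuous coordinate `x : ℂⁿ → ℂ`: every `C¹` loop `L` on `Z` with `L(t) = Φ(x(L(t)))`,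
  `x(L(t)) ∈ S` on `[0,1]` has symbol `(Z, ω, L) ∼ 0`.  Indeed `L = Ψ ∘ ℓ` for the planar loop
  `ℓ = x ∘ L` in the subspace `S` and the continuous map `Ψ = Φ|_S : S → Z(ℂ)`; `S` is
  contractible (`StarConvex.contractibleSpace`), hence simply connected, so `ℓ` is null-homotopic
  (`SimplyConnectedSpace.paths_homotopic`), hence so is `L` (`Path.Homotopic.map`), and
  `span_single_of_nullhomotopic` (homotopy invariance of the symbol, from (R5)) concludes;
* `span_of_chart_loop` — the bookkeeping for four `C¹` paths `e₂, f, e₃, γ` on a plane curve lying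
  on the graph chart `z ↦ (z, Y z)` over `S` and forming the loop `γ(0) →e₂→ →f→ →e₃→ γ(1)`:
  `(e₂) + (f) + (e₃) − (γ) ∼ 0` (the `C¹` concatenation `e₂ ⋆ (f ⋆ (e₃ ⋆ γ⁻))`, `span_concat`,
  `span_single_add_single_reverse`);
* `stub_sectorLoopZ` — the registered statement (the sector chart
  `Y(z) = e^{−iπ/(2N)} (i(1 − z^N))^{1/N}` of `F_N`; all analytic facts are hypotheses).

References: A. Huber, G. Wüstholz, *Transcendence and Linear Relations of 1-Periods*, Cambridge
Tracts in Mathematics 227, CUP 2022, §3.3.1 (relative homology by smooth paths, homotopy)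
[HuberWustholz2022]; B. Gross, *On the periods of abelian integrals and a formula of Chowla and
Selberg*, Invent. Math. 45 (1978), §1 with Rohrlich's appendix [Gross1978].  No new definition, no
named fact.
-/

noncomputable section

open scoped BigOperators unitInterval
open MeasureTheory Set MvPolynomial
open Literature.NumberTheory.Transcendental Literature.NumberTheory.Transcendental.CurvePeriods

namespace Summit.KontsevichZagierPeriods.FermatIsogeny.BetaLinearSector

/-! ## Loops factoring through a star-shaped planar set are null -/

/-- **A `C¹` loop on `Z` which factors through a chart over a star-shaped planar set has symbol
`∼ 0`.** Let `S ⊆ ℂ` be star-shaped at `c`, `Φ : ℂ → ℂⁿ` continuous on `S` with `Φ(S) ⊆ Z(ℂ)`,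
`x : ℂⁿ → ℂ` continuous, and `L` a `C¹` path on `Z` (algebraic end points) with
`L(t) = Φ(x(L(t)))`, `x(L(t)) ∈ S` for `t ∈ [0,1]` and `x(L(0)) = x(L(1))`.  Then `(Z, ω, L)` lies in
the span of the elementary relations: `L = Ψ ∘ ℓ` on `[0,1]` with `ℓ = x ∘ L` a loop in the
subspace `S` and `Ψ = Φ|_S : S → Z(ℂ)` continuous; `S` is contractible, hence simply connected, so
`ℓ ≃ const` rel end points, hence `Ψ ∘ ℓ ≃ const` in `Z(ℂ)`, and null-homotopic `C¹` loops have
symbol `∼ 0` (`span_single_of_nullhomotopic`). [cite: HuberWustholz2022, §3.3.1] -/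
theorem span_single_of_loop_over_starConvex {Z : CurveData} (hZ : Z.IsSmoothAffineCurve)
    (ω : Fin Z.n → MvPolynomial (Fin Z.n) ℂ) (h : ∀ i, HasAlgCoeffs (ω i)) {S : Set ℂ} {c : ℂ}
    (hS : StarConvex ℝ c S) (Φ : ℂ → (Fin Z.n → ℂ)) (hΦc : ContinuousOn Φ S)
    (hΦZ : ∀ z ∈ S, Φ z ∈ Z.points) (x : (Fin Z.n → ℂ) → ℂ) (hx : Continuous x)
    (L : CurvePath Z)
    (hL : ∀ t ∈ Icc (0 : ℝ) 1, L.toFun t = Φ (x (L.toFun t)) ∧ x (L.toFun t) ∈ S)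
    (h01 : x (L.toFun 0) = x (L.toFun 1)) :
    ∃ (k : ℕ) (ρ : Fin k → (PeriodSymbol →₀ ℂ)) (a : Fin k → ℂ),
      (∀ l, IsElementaryRelation (ρ l)) ∧ (∀ l, IsAlgebraic ℚ (a l)) ∧
        Finsupp.single (⟨Z, hZ, ω, h, L⟩ : PeriodSymbol) (1 : ℂ) = ∑ l, a l • ρ l := by
  have hI0 : (0 : ℝ) ∈ Icc (0 : ℝ) 1 := ⟨le_rfl, zero_le_one⟩
  haveI : ContractibleSpace S := hS.contractibleSpace ⟨_, (hL 0 hI0).2⟩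
  -- the planar loop `ℓ = x ∘ L` in the subspace `S`
  have hc : Continuous fun t : I => x (L.toFun t) :=
    hx.comp (L.contDiffOn.continuousOn.comp_continuous continuous_subtype_val fun t => t.2)
  let k₀ : S := ⟨x (L.toFun 0), (hL 0 hI0).2⟩
  let ℓ : Path k₀ k₀ :=
    { toFun := fun t => ⟨x (L.toFun t), (hL t t.2).2⟩
      continuous_toFun := hc.subtype_mk _
      source' := rfl
      target' := Subtype.ext h01.symm }
  -- the chart as a continuous map `S → Z(ℂ)`
  let Ψ : C(S, Z.points) :=
    ⟨fun k => ⟨Φ k, hΦZ k k.2⟩,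
      (hΦc.comp_continuous continuous_subtype_val fun k => k.2).subtype_mk _⟩
  have hrefl : (Path.refl k₀).map Ψ.continuous = Path.refl (Ψ k₀) := by
    ext
    rfl
  have hp : (ℓ.map Ψ.continuous).Homotopic (Path.refl (Ψ k₀)) := by
    have h' := (SimplyConnectedSpace.paths_homotopic ℓ (Path.refl k₀)).map Ψ
    rwa [hrefl] at h'
  exact span_single_of_nullhomotopic hZ ω h (ℓ.map Ψ.continuous) hp L fun t => (hL t t.2).1

/-! ## The loop `e₂ ⋆ f ⋆ e₃ ⋆ γ⁻` on a graph chart of a plane curve -/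

/-- **Bookkeeping: four paths on a graph chart forming a loop.** Let `Z ⊂ ℂ²` be a smooth affine
plane curve, `S ⊆ ℂ` star-shaped at `c`, `Y` continuous on `S` with `(z, Y z) ∈ Z` for `z ∈ S`,
and `γ, e₂, f, e₃` four `C¹` paths on `Z` (algebraic end points) whose values on `[0,1]` lie on the
graph chart (`second coordinate = Y(first coordinate)`, first coordinate in `S`), with
`e₂(0) = γ(0)`, `e₂(1) = f(0)`, `f(1) = e₃(0)`, `e₃(1) = γ(1)`.  Then
`(Z, ω, e₂) + (Z, ω, f) + (Z, ω, e₃) − (Z, ω, γ)` lies in the span of the elementary relations: the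
`C¹` loop `L = e₂ ⋆ (f ⋆ (e₃ ⋆ γ⁻))` stays on the chart (the concatenation only evaluates its pieces
on `[0,1]`), so `(L) ∼ 0` by `span_single_of_loop_over_starConvex`, and
`(L) ∼ (e₂) + (f) + (e₃) + (γ⁻)`, `(γ) + (γ⁻) ∼ 0` (`span_concat`, `span_single_add_single_reverse`).
[cite: HuberWustholz2022, §3.3.1] -/
theorem span_of_chart_loop {m : ℕ} (F : Fin m → MvPolynomial (Fin 2) ℂ)
    (hZ : (⟨2, m, F⟩ : CurveData).IsSmoothAffineCurve)
    (ω : Fin 2 → MvPolynomial (Fin 2) ℂ) (hω : ∀ i, HasAlgCoeffs (ω i)) {S : Set ℂ} {c : ℂ}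
    (hS : StarConvex ℝ c S) (Y : ℂ → ℂ) (hYc : ContinuousOn Y S)
    (hmem : ∀ z ∈ S, (![z, Y z] : Fin 2 → ℂ) ∈ (⟨2, m, F⟩ : CurveData).points)
    (γ e₂ f e₃ : CurvePath (⟨2, m, F⟩ : CurveData))
    (hγ : ∀ t ∈ Icc (0 : ℝ) 1, γ.toFun t = ![γ.toFun t 0, Y (γ.toFun t 0)] ∧ γ.toFun t 0 ∈ S)
    (he₂ : ∀ t ∈ Icc (0 : ℝ) 1, e₂.toFun t = ![e₂.toFun t 0, Y (e₂.toFun t 0)] ∧ e₂.toFun t 0 ∈ S)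
    (hf : ∀ t ∈ Icc (0 : ℝ) 1, f.toFun t = ![f.toFun t 0, Y (f.toFun t 0)] ∧ f.toFun t 0 ∈ S)
    (he₃ : ∀ t ∈ Icc (0 : ℝ) 1, e₃.toFun t = ![e₃.toFun t 0, Y (e₃.toFun t 0)] ∧ e₃.toFun t 0 ∈ S)
    (h₁ : e₂.toFun 0 = γ.toFun 0) (h₂ : e₂.toFun 1 = f.toFun 0) (h₃ : f.toFun 1 = e₃.toFun 0)
    (h₄ : e₃.toFun 1 = γ.toFun 1) :
    ∃ (k : ℕ) (ρ : Fin k → (PeriodSymbol →₀ ℂ)) (a : Fin k → ℂ),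
      (∀ l, IsElementaryRelation (ρ l)) ∧ (∀ l, IsAlgebraic ℚ (a l)) ∧
      (Finsupp.single (⟨⟨2, m, F⟩, hZ, ω, hω, e₂⟩ : PeriodSymbol) (1 : ℂ) +
          Finsupp.single (⟨⟨2, m, F⟩, hZ, ω, hω, f⟩ : PeriodSymbol) (1 : ℂ) +
          Finsupp.single (⟨⟨2, m, F⟩, hZ, ω, hω, e₃⟩ : PeriodSymbol) (1 : ℂ) -
          Finsupp.single (⟨⟨2, m, F⟩, hZ, ω, hω, γ⟩ : PeriodSymbol) (1 : ℂ)) =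
        ∑ l, a l • ρ l := by
  -- junctions of the loop `e₂ ⋆ (f ⋆ (e₃ ⋆ γ⁻))`
  have j₃ : e₃.toFun 1 = γ.reverse.toFun 0 := by rw [h₄]; simp [CurvePath.reverse]
  have j₂ : f.toFun 1 = (e₃.concat γ.reverse j₃).toFun 0 := by rw [CurvePath.concat_zero, h₃]
  have j₁ : e₂.toFun 1 = (f.concat (e₃.concat γ.reverse j₃) j₂).toFun 0 := by
    rw [CurvePath.concat_zero, h₂]
  -- the loop is null
  have hnull : ∃ (k : ℕ) (ρ : Fin k → (PeriodSymbol →₀ ℂ)) (a : Fin k → ℂ),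
      (∀ l, IsElementaryRelation (ρ l)) ∧ (∀ l, IsAlgebraic ℚ (a l)) ∧
        Finsupp.single (⟨⟨2, m, F⟩, hZ, ω, hω,
          e₂.concat (f.concat (e₃.concat γ.reverse j₃) j₂) j₁⟩ : PeriodSymbol) (1 : ℂ) =
          ∑ l, a l • ρ l := by
    let T : Set (Fin 2 → ℂ) := {v | v = ![v 0, Y (v 0)] ∧ v 0 ∈ S}
    have hγr : ∀ t ∈ Icc (0 : ℝ) 1, γ.reverse.toFun t ∈ T := fun t ht =>
      hγ (1 - t) (one_sub_mem_Icc ht)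
    have hLT : ∀ t ∈ Icc (0 : ℝ) 1,
        (e₂.concat (f.concat (e₃.concat γ.reverse j₃) j₂) j₁).toFun t ∈ T :=
      CurvePath.concat_mem _ _ j₁ (S := T) he₂
        (CurvePath.concat_mem _ _ j₂ (S := T) hf (CurvePath.concat_mem _ _ j₃ (S := T) he₃ hγr))
    have h01 : (e₂.concat (f.concat (e₃.concat γ.reverse j₃) j₂) j₁).toFun 0 =
        (e₂.concat (f.concat (e₃.concat γ.reverse j₃) j₂) j₁).toFun 1 := by
      rw [CurvePath.concat_zero, CurvePath.concat_one, CurvePath.concat_one, CurvePath.concat_one,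
        h₁]
      simp [CurvePath.reverse]
    have hΦc : ContinuousOn (fun z : ℂ => (![z, Y z] : Fin 2 → ℂ)) S := by
      refine continuousOn_pi.2 fun i => ?_
      fin_cases i
      · simpa using continuousOn_id' S
      · simpa using hYc
    exact span_single_of_loop_over_starConvex hZ ω hω hS (fun z => (![z, Y z] : Fin 2 → ℂ)) hΦc
      hmem (fun v => v 0) (continuous_apply 0) _ hLT (congrArg (fun v => v 0) h01)
  -- bookkeeping
  have c₁ := span_concat hZ ω hω e₂ (f.concat (e₃.concat γ.reverse j₃) j₂) j₁
  have c₂ := span_concat hZ ω hω f (e₃.concat γ.reverse j₃) j₂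
  have c₃ := span_concat hZ ω hω e₃ γ.reverse j₃
  have r := span_single_add_single_reverse hZ ω hω γ
  obtain ⟨k, ρ, a, hρ, ha, he⟩ := span_sub (span_sub (span_sub (span_sub hnull c₁) c₂) c₃) r
  exact ⟨k, ρ, a, hρ, ha, by rw [← he]; abel⟩

/-! ## The registered stub -/

/-- SECTOR STUB H1 (the loop in the affine chart `Z = F_N` is null-homotopic ⇒ its symbol is
`∼ 0`). Pure topology: if `Y(z) = e^{−iπ/(2N)} (i(1 − z^N))^{1/N}` is continuous on a set `S ⊆ ℂ`
star-shaped at `0` with `Φ(z) = (z, Y z) ∈ F_N`, and four `C¹` paths `e₂, f, e₃, γ` on `F_N` lie on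
the chart over `S` (second coordinate = `Y` of the first, first coordinate in `S`) and form the
loop `γ(0) →e₂→ · →f→ · →e₃→ γ(1)` closed by `γ⁻`, then `(e₂) + (f) + (e₃) − (γ) ∼ 0`: the loop is
`Φ ∘ (planar loop in S)`, `S` is contractible (`StarConvex.contractibleSpace`), so the loop is
null-homotopic in `F_N(ℂ)` (`Path.Homotopic.map`) and `span_single_of_nullhomotopic`,
`span_concat`, `span_single_add_single_reverse` conclude (`span_of_chart_loop`).
[cite: HuberWustholz2022, §3.3.1 (pp. 42–44)] -/
theorem stub_sectorLoopZ : ∀ (N : ℕ), 1 ≤ N → ∀ (S : Set ℂ), StarConvex ℝ (0 : ℂ) S →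
    ContinuousOn (fun z : ℂ => Complex.exp (-(↑Real.pi * Complex.I / (2 * (N : ℂ)))) * (Complex.I * (1 - z ^ N)) ^ ((N : ℂ)⁻¹)) S →
    (∀ z : ℂ, (![z, Complex.exp (-(↑Real.pi * Complex.I / (2 * (N : ℂ)))) * (Complex.I * (1 - z ^ N)) ^ ((N : ℂ)⁻¹)] :
        Fin 2 → ℂ) ∈ (⟨2, 1, ![X 0 ^ N + X 1 ^ N - 1]⟩ : CurveData).points) →
    ∀ (hZ : (⟨2, 1, ![X 0 ^ N + X 1 ^ N - 1]⟩ : CurveData).IsSmoothAffineCurve)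
      (ω : Fin 2 → MvPolynomial (Fin 2) ℂ) (hω : ∀ i, HasAlgCoeffs (ω i))
      (γ e₂ f e₃ : CurvePath (⟨2, 1, ![X 0 ^ N + X 1 ^ N - 1]⟩ : CurveData)),
    (∀ t ∈ Set.Icc (0:ℝ) 1, γ.toFun t = ![γ.toFun t 0, Complex.exp (-(↑Real.pi * Complex.I / (2 * (N : ℂ)))) *
        (Complex.I * (1 - (γ.toFun t 0) ^ N)) ^ ((N : ℂ)⁻¹)] ∧ γ.toFun t 0 ∈ S) →
    (∀ t ∈ Set.Icc (0:ℝ) 1, e₂.toFun t = ![e₂.toFun t 0, Complex.exp (-(↑Real.pi * Complex.I / (2 * (N : ℂ)))) *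
        (Complex.I * (1 - (e₂.toFun t 0) ^ N)) ^ ((N : ℂ)⁻¹)] ∧ e₂.toFun t 0 ∈ S) →
    (∀ t ∈ Set.Icc (0:ℝ) 1, f.toFun t = ![f.toFun t 0, Complex.exp (-(↑Real.pi * Complex.I / (2 * (N : ℂ)))) *
        (Complex.I * (1 - (f.toFun t 0) ^ N)) ^ ((N : ℂ)⁻¹)] ∧ f.toFun t 0 ∈ S) →
    (∀ t ∈ Set.Icc (0:ℝ) 1, e₃.toFun t = ![e₃.toFun t 0, Complex.exp (-(↑Real.pi * Complex.I / (2 * (N : ℂ)))) *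
        (Complex.I * (1 - (e₃.toFun t 0) ^ N)) ^ ((N : ℂ)⁻¹)] ∧ e₃.toFun t 0 ∈ S) →
    e₂.toFun 0 = γ.toFun 0 → e₂.toFun 1 = f.toFun 0 → f.toFun 1 = e₃.toFun 0 → e₃.toFun 1 = γ.toFun 1 →
    ∃ (k : ℕ) (ρ : Fin k → (PeriodSymbol →₀ ℂ)) (a : Fin k → ℂ),
      (∀ l, IsElementaryRelation (ρ l)) ∧ (∀ l, IsAlgebraic ℚ (a l)) ∧
      (Finsupp.single (⟨(⟨2, 1, ![X 0 ^ N + X 1 ^ N - 1]⟩ : CurveData), hZ, ω, hω, e₂⟩ : PeriodSymbol) (1 : ℂ) +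
          Finsupp.single (⟨(⟨2, 1, ![X 0 ^ N + X 1 ^ N - 1]⟩ : CurveData), hZ, ω, hω, f⟩ : PeriodSymbol) (1 : ℂ) +
          Finsupp.single (⟨(⟨2, 1, ![X 0 ^ N + X 1 ^ N - 1]⟩ : CurveData), hZ, ω, hω, e₃⟩ : PeriodSymbol) (1 : ℂ) -
          Finsupp.single (⟨(⟨2, 1, ![X 0 ^ N + X 1 ^ N - 1]⟩ : CurveData), hZ, ω, hω, γ⟩ : PeriodSymbol) (1 : ℂ)) =
        ∑ l, a l • ρ l := by
  intro N _ S hS hYc hmem hZ ω hω γ e₂ f e₃ hγ he₂ hf he₃ h₁ h₂ h₃ h₄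
  exact span_of_chart_loop (![X 0 ^ N + X 1 ^ N - 1]) hZ ω hω hS
    (fun z : ℂ => Complex.exp (-(↑Real.pi * Complex.I / (2 * (N : ℂ)))) *
      (Complex.I * (1 - z ^ N)) ^ ((N : ℂ)⁻¹))
    hYc (fun z _ => hmem z) γ e₂ f e₃ hγ he₂ hf he₃ h₁ h₂ h₃ h₄

end Summit.KontsevichZagierPeriods.FermatIsogeny.BetaLinearSector

end
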